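import Literature.Geometry.Riemannian.GeneralizedCylinderMeanCurvature
import Literature.Geometry.Riemannian.RicciDeTurckNaturality
import Literature.Geometry.Lorentzian.MaxAtlasChart
import Literature.Geometry.Lorentzian.ChartMetricCoord
import Literature.Geometry.Lorentzian.HypersurfaceRestriction
import HarnessLib

/-!
# The slices of a generalized cylinder read in a chart: components and the scalar curvature
# formula in coordinates (Bär–Hanke 2023, §3, (9))

Topic `Literature/Geometry/Riemannian`. A brick (T3 of the notes) of the proof programme of
`Literature.Geometry.Riemannian.BaerHankePscGluing`. For a Riemannian generalized cylinder
`G = g_t + dt²` on `N × ℝ` (`N` modelled on the normed space `E'` itself) and a chart `ψ` of the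
maximal atlas of `N`, the slice metrics `g_t` are read in `ψ` through the representatives
`F(y, t) = metricRepr g_t ψ y : E' →L E' →L ℝ` of `MaxAtlasChart.lean`
(`F(y,t)(a,b) = G_{(ψ⁻¹y, t)}((dψ⁻¹ a, 0), (dψ⁻¹ b, 0))`, `cylRepr_apply`). We prove:

* `contDiffOn_cylRepr` — **`F` is `C^∞` jointly in `(y, t)`** on `ψ.target × ℝ` (the cylinder
  pulled back to the open subset `ψ.target × ℝ` of the normed space `E' × ℝ` has a smooth
  representative, `OpensChart.isMetricOn_repr`, of which `F` is the `E' × 0`-block);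
* `contDiffOn_cylComponents`, `contDiff_cylComponents_right`, `hasDerivAt_cylComponents_apply₂`,
  `cylComponents_apply` — the same for any function `F` agreeing with the representatives;
* `secondFundamentalForm_slice_eq_half_deriv` — `K_t(dψ⁻¹a, dψ⁻¹b) = ½ ∂_t F(y,t)(a,b)`
  (Bär–Hanke (8), `hasDerivAt_cyl_val_two_mul`);
* `meanCurvature_slice_eq_mtrAt`, `normSq_slice_eq_normSqAt`, `scalarCurvature_slice_eq_scalAt`
  — the mean curvature, `|K_t|²` and the scalar curvature of the slice `t` at `ψ⁻¹ y` are the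
  coordinate objects `mtrAt`, `normSqAt`, `scalAt` (`CoordCurvature.lean`) of `F(·, t)` and
  `½ ∂_t F` at `y` (naturality of trace / square norm / scalar curvature under the chart,
  `trace_comap_eq`, `normSq_comap_eq`, `MaxAtlasChart.scalarCurvature_inv_eq`);
* `cyl_scalarCurvature_eq_coord` — **formula (9) in coordinates**:
  `scal_G(ψ⁻¹y, t) = scalAt F(·,t) y − normSqAt(½Ḟ) − mtrAt(½Ḟ)² − 2 ∂_t[mtrAt F(·,τ) y (½Ḟ(y,τ))]`
  (`cyl_scalarCurvature_eq` of `GeneralizedCylinderMeanCurvature.lean`).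

This is the dictionary through which the deformation estimates of Bär–Hanke §3 (Props. 23, 26)
are carried out in coordinates. Everything is proved; no definitions, no named facts (D-0026).

## References

* C. Bär, B. Hanke, *Boundary conditions for scalar curvature*, arXiv:2012.09127, §3, (7)–(9).
  [BarHanke2023]
* B. O'Neill, *Semi-Riemannian geometry* (1983), Ch. 3, Prop. 3.59, pp. 60–61, 90–91.
  [ONeill1983]
-/

noncomputable section

set_option synthInstance.maxHeartbeats 400000

open Bundle Set Filter Function Metric TopologicalSpace
open scoped Manifold ContDiff Topology

namespace Literature.Geometry.Riemannian

open Literature.Geometry.Lorentzian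
open Literature.Geometry.Lorentzian.PseudoRiemannianMetric

variable {E' : Type*} [NormedAddCommGroup E'] [NormedSpace ℝ E'] [FiniteDimensional ℝ E']
  [CompleteSpace E']
  {N : Type*} [TopologicalSpace N] [ChartedSpace E' N] [IsManifold 𝓘(ℝ, E') ∞ N]
  (G : PseudoRiemannianMetric (𝓘(ℝ, E').prod 𝓘(ℝ, ℝ)) ∞ (E' × ℝ)
    (TangentSpace (𝓘(ℝ, E').prod 𝓘(ℝ, ℝ)) : N × ℝ → Type _)) [G.HasLeviCivita]
  {ψ : OpenPartialHomeomorph N E'}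

/-! ### The representative of a slice and its value formula -/

omit [CompleteSpace E'] [G.HasLeviCivita] in
/-- **The slice components**: for `p ∈ ψ.target`,
`metricRepr g_t ψ p (a, b) = G_{(ψ⁻¹ p, t)}((dψ⁻¹ a, 0), (dψ⁻¹ b, 0))` (the induced metric of
the slice is `G` on horizontal vectors, `mfderiv_cylSlice_apply`). [cite: BarHanke2023, §3, (7)] -/
theorem cylRepr_apply (hG : G.IsRiemannian) (hψ : ψ ∈ IsManifold.maximalAtlas 𝓘(ℝ, E') ∞ N)
    (t : ℝ) (p : MaxAtlasChart.target ψ) (a b : E') :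
    MaxAtlasChart.metricRepr (G.inducedMetric (fun y : N ↦ ((y, t) : N × ℝ))
        (contMDiff_pullbackBilin_holds (I := 𝓘(ℝ, E').prod 𝓘(ℝ, ℝ)) (M := N × ℝ)
          (I' := 𝓘(ℝ, E')) (N := N))
        (isSpacelikeImmersion_cylSlice G hG t)) hψ p a b =
      G.val (ψ.symm p, t)
        ((mfderiv 𝓘(ℝ, E') 𝓘(ℝ, E') ψ.symm (p : E') a, 0) :
          TangentSpace (𝓘(ℝ, E').prod 𝓘(ℝ, ℝ)) (ψ.symm p, t))
        ((mfderiv 𝓘(ℝ, E') 𝓘(ℝ, E') ψ.symm (p : E') b, 0) :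
          TangentSpace (𝓘(ℝ, E').prod 𝓘(ℝ, ℝ)) (ψ.symm p, t)) := by
  rw [← MaxAtlasChart.metric_val_eq_repr _ hψ p]
  show G.val (ψ.symm p, t)
      (mfderiv 𝓘(ℝ, E') (𝓘(ℝ, E').prod 𝓘(ℝ, ℝ)) (fun y : N ↦ ((y, t) : N × ℝ)) (ψ.symm p)
        (mfderiv 𝓘(ℝ, E') 𝓘(ℝ, E') (MaxAtlasChart.inv ψ) p a))
      (mfderiv 𝓘(ℝ, E') (𝓘(ℝ, E').prod 𝓘(ℝ, ℝ)) (fun y : N ↦ ((y, t) : N × ℝ)) (ψ.symm p)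
        (mfderiv 𝓘(ℝ, E') 𝓘(ℝ, E') (MaxAtlasChart.inv ψ) p b)) = _
  rw [mfderiv_cylSlice_apply, mfderiv_cylSlice_apply, MaxAtlasChart.mfderiv_inv hψ]
  rfl

/-! ### Joint smoothness of the slice components in `(y, t)` -/

omit [CompleteSpace E'] [G.HasLeviCivita] in
set_option maxHeartbeats 1600000 in
/-- **The slice components are `C^∞` jointly in `(y, t)` on `ψ.target × ℝ`.** Pull the cylinder
back along `e(y, t) = (ψ⁻¹ y, t)` to the open subset `ψ.target × ℝ` of the normed space
`E' × ℝ`; the pulled-back metric has a `C^∞` representative there (`OpensChart.isMetricOn_repr`),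
whose `E' × 0`-block is the slice representative (`cylRepr_apply`, `de(a, 0) = (dψ⁻¹ a, 0)`).
[cite: ONeill1983, Ch. 3, pp. 90–91] -/
theorem contDiffOn_cylRepr (hG : G.IsRiemannian)
    (hψ : ψ ∈ IsManifold.maximalAtlas 𝓘(ℝ, E') ∞ N) :
    ContDiffOn ℝ ∞ (fun q : E' × ℝ ↦ MaxAtlasChart.metricRepr
        (G.inducedMetric (fun y : N ↦ ((y, q.2) : N × ℝ))
          (contMDiff_pullbackBilin_holds (I := 𝓘(ℝ, E').prod 𝓘(ℝ, ℝ)) (M := N × ℝ)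
            (I' := 𝓘(ℝ, E')) (N := N))
          (isSpacelikeImmersion_cylSlice G hG q.2)) hψ q.1)
      (ψ.target ×ˢ (univ : Set ℝ)) := by
  have hUo : IsOpen (ψ.target ×ˢ (univ : Set ℝ)) := ψ.open_target.prod isOpen_univ
  set W : Opens (E' × ℝ) := ⟨ψ.target ×ˢ (univ : Set ℝ), hUo⟩ with hW
  -- the map `Λ (y, t) = (ψ⁻¹ y, t)` and its restriction `e` to `W`
  set Λ : E' × ℝ → N × ℝ := fun q ↦ (ψ.symm q.1, q.2) with hΛ
  have hfst : ContMDiff 𝓘(ℝ, E' × ℝ) 𝓘(ℝ, E') ∞ (Prod.fst : E' × ℝ → E') :=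
    contDiff_fst.contMDiff
  have hsnd : ContMDiff 𝓘(ℝ, E' × ℝ) 𝓘(ℝ, ℝ) ∞ (Prod.snd : E' × ℝ → ℝ) :=
    contDiff_snd.contMDiff
  have hΛ1 : ContMDiffOn 𝓘(ℝ, E' × ℝ) 𝓘(ℝ, E') ∞ (fun q : E' × ℝ ↦ ψ.symm q.1)
      (ψ.target ×ˢ (univ : Set ℝ)) :=
    (contMDiffOn_symm_of_mem_maximalAtlas hψ).comp hfst.contMDiffOn fun q hq ↦ hq.1
  have hΛs : ContMDiffOn 𝓘(ℝ, E' × ℝ) (𝓘(ℝ, E').prod 𝓘(ℝ, ℝ)) ∞ Λ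
      (ψ.target ×ˢ (univ : Set ℝ)) := hΛ1.prodMk hsnd.contMDiffOn
  have hΛat : ∀ q : W, ContMDiffAt 𝓘(ℝ, E' × ℝ) (𝓘(ℝ, E').prod 𝓘(ℝ, ℝ)) ∞ Λ q.1 := fun q ↦
    hΛs.contMDiffAt (hUo.mem_nhds q.2)
  have hΛd : ∀ q : W, MDifferentiableAt 𝓘(ℝ, E' × ℝ) (𝓘(ℝ, E').prod 𝓘(ℝ, ℝ)) Λ q.1 := fun q ↦
    (hΛat q).mdifferentiableAt (by simp)
  -- `dΛ (a, α) = (dψ⁻¹ a, α)`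
  have hsymmd : ∀ q : W, MDifferentiableAt 𝓘(ℝ, E') 𝓘(ℝ, E') ψ.symm q.1.1 := fun q ↦
    (MaxAtlasChart.mdifferentiable_chart hψ).symm.mdifferentiableAt q.2.1
  have hdΛ : ∀ (q : W) (a : E') (α : ℝ),
      mfderiv 𝓘(ℝ, E' × ℝ) (𝓘(ℝ, E').prod 𝓘(ℝ, ℝ)) Λ q.1 (a, α) =
        ((mfderiv 𝓘(ℝ, E') 𝓘(ℝ, E') ψ.symm q.1.1 a, α) :
          TangentSpace (𝓘(ℝ, E').prod 𝓘(ℝ, ℝ)) (Λ q.1)) := by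
    intro q a α
    have hfd : MDifferentiableAt 𝓘(ℝ, E' × ℝ) 𝓘(ℝ, E') (Prod.fst : E' × ℝ → E') q.1 :=
      hfst.mdifferentiableAt (by simp)
    have hsd : MDifferentiableAt 𝓘(ℝ, E' × ℝ) 𝓘(ℝ, ℝ) (Prod.snd : E' × ℝ → ℝ) q.1 :=
      hsnd.mdifferentiableAt (by simp)
    have h1 : MDifferentiableAt 𝓘(ℝ, E' × ℝ) 𝓘(ℝ, E') (ψ.symm ∘ Prod.fst : E' × ℝ → N) q.1 :=
      (hsymmd q).comp q.1 hfd
    have hprod := MDifferentiableAt.mfderiv_prod h1 hsd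
    have hΛeq : Λ = fun q : E' × ℝ ↦ ((ψ.symm ∘ Prod.fst : E' × ℝ → N) q, Prod.snd q) := rfl
    have h2 : mfderiv 𝓘(ℝ, E' × ℝ) 𝓘(ℝ, E') (Prod.fst : E' × ℝ → E') q.1 (a, α) = a := by
      rw [mfderiv_eq_fderiv, fderiv_fst]; rfl
    have h3 : mfderiv 𝓘(ℝ, E' × ℝ) 𝓘(ℝ, ℝ) (Prod.snd : E' × ℝ → ℝ) q.1 (a, α) = α := by
      rw [mfderiv_eq_fderiv, fderiv_snd]; rfl
    rw [hΛeq, hprod]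
    show ((mfderiv 𝓘(ℝ, E' × ℝ) 𝓘(ℝ, E') (ψ.symm ∘ Prod.fst : E' × ℝ → N) q.1 (a, α),
        mfderiv 𝓘(ℝ, E' × ℝ) 𝓘(ℝ, ℝ) (Prod.snd : E' × ℝ → ℝ) q.1 (a, α)) : E' × ℝ) = _
    refine Prod.ext ?_ h3
    show mfderiv 𝓘(ℝ, E' × ℝ) 𝓘(ℝ, E') (ψ.symm ∘ Prod.fst : E' × ℝ → N) q.1 (a, α) =
      mfderiv 𝓘(ℝ, E') 𝓘(ℝ, E') ψ.symm q.1.1 a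
    rw [mfderiv_comp q.1 (hsymmd q) hfd]
    show mfderiv 𝓘(ℝ, E') 𝓘(ℝ, E') ψ.symm ((Prod.fst : E' × ℝ → E') q.1)
      (mfderiv 𝓘(ℝ, E' × ℝ) 𝓘(ℝ, E') (Prod.fst : E' × ℝ → E') q.1 (a, α)) = _
    rw [h2]
  set e : W → N × ℝ := Λ ∘ Subtype.val with he_def
  have he : ContMDiff 𝓘(ℝ, E' × ℝ) (𝓘(ℝ, E').prod 𝓘(ℝ, ℝ)) (∞ + 1) e := by
    have h : ((∞ : ℕ∞ω) + 1) = ∞ := rfl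
    rw [h]
    exact hΛs.comp_contMDiff contMDiff_subtype_val fun q ↦ q.2
  have hde : ∀ (q : W) (a : E') (α : ℝ),
      mfderiv 𝓘(ℝ, E' × ℝ) (𝓘(ℝ, E').prod 𝓘(ℝ, ℝ)) e q (a, α) =
        ((mfderiv 𝓘(ℝ, E') 𝓘(ℝ, E') ψ.symm q.1.1 a, α) :
          TangentSpace (𝓘(ℝ, E').prod 𝓘(ℝ, ℝ)) (Λ q.1)) := by
    intro q a α
    rw [he_def, mfderiv_comp_subtypeVal (hΛd q)]
    exact hdΛ q a α
  have he' : ∀ q : W, Injective (mfderiv 𝓘(ℝ, E' × ℝ) (𝓘(ℝ, E').prod 𝓘(ℝ, ℝ)) e q) := by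
    rintro q ⟨a, α⟩ ⟨a', α'⟩ h
    rw [hde, hde] at h
    have h1 : mfderiv 𝓘(ℝ, E') 𝓘(ℝ, E') ψ.symm q.1.1 a =
        mfderiv 𝓘(ℝ, E') 𝓘(ℝ, E') ψ.symm q.1.1 a' := congrArg Prod.fst h
    have h2 : α = α' := congrArg Prod.snd h
    rw [(MaxAtlasChart.mdifferentiable_chart hψ).symm.mfderiv_injective q.2.1 h1, h2]
  -- the pulled-back cylinder on `W` and its representative
  set GW := G.comap (contMDiff_pullbackBilin_holds (I := 𝓘(ℝ, E').prod 𝓘(ℝ, ℝ)) (M := N × ℝ)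
    (I' := 𝓘(ℝ, E' × ℝ)) (N := W)) e he he' rfl with hGW
  classical
  set 𝔊 : E' × ℝ → (E' × ℝ) →L[ℝ] (E' × ℝ) →L[ℝ] ℝ :=
    fun q ↦ if hq : q ∈ (W : Set (E' × ℝ)) then GW.val ⟨q, hq⟩ else 0 with h𝔊def
  have h𝔊 : ∀ q : W, GW.val q = 𝔊 q := fun q ↦ by
    have hq : (q : E' × ℝ) ∈ (W : Set (E' × ℝ)) := q.2
    simp only [h𝔊def, dif_pos hq]
  have h𝔊s : ContDiffOn ℝ ∞ 𝔊 (ψ.target ×ˢ (univ : Set ℝ)) :=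
    (OpensChart.isMetricOn_repr (U := W) h𝔊).contDiffOn
  -- the `E' × 0`-block as a continuous linear operation
  set ι : E' →L[ℝ] E' × ℝ := ContinuousLinearMap.inl ℝ E' ℝ with hι
  set Ψ₁ : ((E' × ℝ) →L[ℝ] (E' × ℝ) →L[ℝ] ℝ) →L[ℝ] (E' →L[ℝ] (E' × ℝ) →L[ℝ] ℝ) :=
    (ContinuousLinearMap.compL ℝ E' (E' × ℝ) ((E' × ℝ) →L[ℝ] ℝ)).flip ι with hΨ₁
  set Ψ₂ : ((E' × ℝ) →L[ℝ] ℝ) →L[ℝ] (E' →L[ℝ] ℝ) :=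
    (ContinuousLinearMap.compL ℝ E' (E' × ℝ) ℝ).flip ι with hΨ₂
  set Ψ₃ : (E' →L[ℝ] (E' × ℝ) →L[ℝ] ℝ) →L[ℝ] (E' →L[ℝ] E' →L[ℝ] ℝ) :=
    ContinuousLinearMap.compL ℝ E' ((E' × ℝ) →L[ℝ] ℝ) (E' →L[ℝ] ℝ) Ψ₂ with hΨ₃
  set Φ : ((E' × ℝ) →L[ℝ] (E' × ℝ) →L[ℝ] ℝ) →L[ℝ] (E' →L[ℝ] E' →L[ℝ] ℝ) := Ψ₃.comp Ψ₁
    with hΦ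
  have hΦapply : ∀ (B : (E' × ℝ) →L[ℝ] (E' × ℝ) →L[ℝ] ℝ) (a b : E'),
      Φ B a b = B (a, 0) (b, 0) := fun B a b ↦ by
    simp only [hΦ, hΨ₃, hΨ₁, hΨ₂, hι, ContinuousLinearMap.comp_apply,
      ContinuousLinearMap.compL_apply, ContinuousLinearMap.flip_apply,
      ContinuousLinearMap.inl_apply]
  -- the slice representative is the block of the cylinder representative
  have hblock : ∀ q ∈ ψ.target ×ˢ (univ : Set ℝ),
      MaxAtlasChart.metricRepr (G.inducedMetric (fun y : N ↦ ((y, q.2) : N × ℝ))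
        (contMDiff_pullbackBilin_holds (I := 𝓘(ℝ, E').prod 𝓘(ℝ, ℝ)) (M := N × ℝ)
          (I' := 𝓘(ℝ, E')) (N := N))
        (isSpacelikeImmersion_cylSlice G hG q.2)) hψ q.1 = Φ (𝔊 q) := by
    rintro ⟨y, t⟩ hq
    refine ContinuousLinearMap.ext fun a ↦ ContinuousLinearMap.ext fun b ↦ ?_
    rw [hΦapply, cylRepr_apply G hG hψ t ⟨y, hq.1⟩ a b, ← h𝔊 ⟨(y, t), hq⟩]
    show _ = pullbackBilin (I := 𝓘(ℝ, E').prod 𝓘(ℝ, ℝ)) (I' := 𝓘(ℝ, E' × ℝ)) e G.val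
      ⟨(y, t), hq⟩ (a, 0) (b, 0)
    rw [pullbackBilin_apply, hde, hde]
    rfl
  refine (Φ.contDiff.comp_contDiffOn h𝔊s).congr fun q hq ↦ ?_
  exact hblock q hq

/-! ### Reading `K_t`, `H_t`, `|K_t|²` and the scalar curvatures in the chart -/

section Dictionary

variable (hG : G.IsRiemannian)
  (hcyl : ∀ (p : N × ℝ) (v w : TangentSpace (𝓘(ℝ, E').prod 𝓘(ℝ, ℝ)) p),
    G.val p v w = G.val p ((v.1, 0) : TangentSpace (𝓘(ℝ, E').prod 𝓘(ℝ, ℝ)) p)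
      ((w.1, 0) : TangentSpace (𝓘(ℝ, E').prod 𝓘(ℝ, ℝ)) p) + v.2 * w.2)
  (hψ : ψ ∈ IsManifold.maximalAtlas 𝓘(ℝ, E') ∞ N)
  (F : E' → ℝ → E' →L[ℝ] E' →L[ℝ] ℝ)
  (hF : ∀ (y : E') (s : ℝ), F y s = MaxAtlasChart.metricRepr
    (G.inducedMetric (fun x : N ↦ ((x, s) : N × ℝ))
      (contMDiff_pullbackBilin_holds (I := 𝓘(ℝ, E').prod 𝓘(ℝ, ℝ)) (M := N × ℝ)
        (I' := 𝓘(ℝ, E')) (N := N))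
      (isSpacelikeImmersion_cylSlice G hG s)) hψ y)

include hF

omit [CompleteSpace E'] [G.HasLeviCivita] in
/-- The slice components, as a function of `(y, s)`, are `C^∞` on `ψ.target × ℝ`
(`contDiffOn_cylRepr` restated for `F`). [folklore] -/
theorem contDiffOn_cylComponents :
    ContDiffOn ℝ ∞ (fun q : E' × ℝ ↦ F q.1 q.2) (ψ.target ×ˢ (univ : Set ℝ)) := by
  have h := contDiffOn_cylRepr G hG hψ
  refine h.congr fun q _ ↦ ?_
  exact hF q.1 q.2

omit [CompleteSpace E'] [G.HasLeviCivita] in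
/-- For `p ∈ ψ.target`, `s ↦ F(p, s)` is `C^∞`. [folklore] -/
theorem contDiff_cylComponents_right (p : MaxAtlasChart.target ψ) :
    ContDiff ℝ ∞ (fun s : ℝ ↦ F p s) := by
  have h := contDiffOn_cylComponents G hG hψ F hF
  have hc : ContDiff ℝ ∞ (fun s : ℝ ↦ (((p : E'), s) : E' × ℝ)) := contDiff_const.prodMk contDiff_id
  rw [contDiff_iff_contDiffAt]
  intro s
  have hq : (((p : E'), s) : E' × ℝ) ∈ ψ.target ×ˢ (univ : Set ℝ) := ⟨p.2, mem_univ _⟩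
  exact (h.contDiffAt ((ψ.open_target.prod isOpen_univ).mem_nhds hq)).comp s hc.contDiffAt

omit [CompleteSpace E'] [G.HasLeviCivita] in
/-- Entrywise derivative: `∂_s (F(p,s)(a,b)) = (∂_s F(p,s))(a,b)`. [folklore] -/
theorem hasDerivAt_cylComponents_apply₂ (p : MaxAtlasChart.target ψ) (t : ℝ) (a b : E') :
    HasDerivAt (fun s : ℝ ↦ F p s a b) (deriv (fun s : ℝ ↦ F p s) t a b) t := by
  have hd : HasDerivAt (fun s : ℝ ↦ F p s) (deriv (fun s : ℝ ↦ F p s) t) t :=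
    ((contDiff_cylComponents_right G hG hψ F hF p).differentiable (by simp) t).hasDerivAt
  have h1 := hd.clm_apply (hasDerivAt_const t a)
  simp only [map_zero, add_zero] at h1
  have h2 := h1.clm_apply (hasDerivAt_const t b)
  simpa using h2

omit [CompleteSpace E'] [G.HasLeviCivita] in
/-- The value formula for `F`: `F(p,s)(a,b) = G_{(ψ⁻¹p, s)}((dψ⁻¹a, 0), (dψ⁻¹b, 0))`.
[cite: BarHanke2023, §3, (7)] -/
theorem cylComponents_apply (p : MaxAtlasChart.target ψ) (s : ℝ) (a b : E') :
    F p s a b = G.val (ψ.symm p, s)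
        ((mfderiv 𝓘(ℝ, E') 𝓘(ℝ, E') ψ.symm (p : E') a, 0) :
          TangentSpace (𝓘(ℝ, E').prod 𝓘(ℝ, ℝ)) (ψ.symm p, s))
        ((mfderiv 𝓘(ℝ, E') 𝓘(ℝ, E') ψ.symm (p : E') b, 0) :
          TangentSpace (𝓘(ℝ, E').prod 𝓘(ℝ, ℝ)) (ψ.symm p, s)) := by
  rw [hF]
  exact cylRepr_apply G hG hψ s p a b

include hcyl

omit [CompleteSpace E'] in
/-- **`K_t = ½ ġ_t` in the chart**: `K_t(ψ⁻¹p)(dψ⁻¹a, dψ⁻¹b) = ½ ∂_t F(p,t)(a,b)`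
(`hasDerivAt_cyl_val_two_mul`; Bär–Hanke 2023, (8)). [cite: BarHanke2023, §3, (8)] -/
theorem secondFundamentalForm_slice_eq_half_deriv (p : MaxAtlasChart.target ψ) (t : ℝ)
    (a b : E') :
    G.secondFundamentalForm 𝓘(ℝ, E') (fun y : N ↦ ((y, t) : N × ℝ))
        (fun y ↦ velocity (𝓘(ℝ, E').prod 𝓘(ℝ, ℝ)) (fun s : ℝ ↦ ((y, s) : N × ℝ)) t) (ψ.symm p)
        (mfderiv 𝓘(ℝ, E') 𝓘(ℝ, E') ψ.symm (p : E') a)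
        (mfderiv 𝓘(ℝ, E') 𝓘(ℝ, E') ψ.symm (p : E') b) =
      2⁻¹ * deriv (fun s : ℝ ↦ F p s) t a b := by
  have h := hasDerivAt_cyl_val_two_mul G hcyl (ψ.symm p) t
    (mfderiv 𝓘(ℝ, E') 𝓘(ℝ, E') ψ.symm (p : E') a)
    (mfderiv 𝓘(ℝ, E') 𝓘(ℝ, E') ψ.symm (p : E') b)
  have hfun : (fun s : ℝ ↦ F p s a b) = fun τ ↦ G.val (ψ.symm p, τ)
      ((mfderiv 𝓘(ℝ, E') 𝓘(ℝ, E') ψ.symm (p : E') a, 0) :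
        TangentSpace (𝓘(ℝ, E').prod 𝓘(ℝ, ℝ)) (ψ.symm p, τ))
      ((mfderiv 𝓘(ℝ, E') 𝓘(ℝ, E') ψ.symm (p : E') b, 0) :
        TangentSpace (𝓘(ℝ, E').prod 𝓘(ℝ, ℝ)) (ψ.symm p, τ)) :=
    funext fun s ↦ cylComponents_apply G hG hψ F hF p s a b
  have h2 := (hasDerivAt_cylComponents_apply₂ G hG hψ F hF p t a b).deriv
  rw [hfun, h.deriv] at h2
  rw [← h2]
  ring

omit [CompleteSpace E'] in
/-- **The mean curvature of the slice in the chart**: `H_t(ψ⁻¹ p) = mtrAt F(·,t) p (½ ∂_t F(p,t))`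
(naturality of the metric trace under the chart, `trace_comap_eq`, and `trace_eq_mtrAt`).
[cite: ONeill1983, Ch. 3, Prop. 3.59 and pp. 60–61] -/
theorem meanCurvature_slice_eq_mtrAt (p : MaxAtlasChart.target ψ) (t : ℝ) :
    G.meanCurvature (fun y : N ↦ ((y, t) : N × ℝ))
        (contMDiff_pullbackBilin_holds (I := 𝓘(ℝ, E').prod 𝓘(ℝ, ℝ)) (M := N × ℝ)
          (I' := 𝓘(ℝ, E')) (N := N))
        (isSpacelikeImmersion_cylSlice G hG t)
        (fun y ↦ velocity (𝓘(ℝ, E').prod 𝓘(ℝ, ℝ)) (fun s : ℝ ↦ ((y, s) : N × ℝ)) t) (ψ.symm p) =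
      MetricCoord.mtrAt (fun y ↦ F y t) p ((2⁻¹ : ℝ) • deriv (fun s : ℝ ↦ F p s) t) := by
  set gt := G.inducedMetric (fun y : N ↦ ((y, t) : N × ℝ))
    (contMDiff_pullbackBilin_holds (I := 𝓘(ℝ, E').prod 𝓘(ℝ, ℝ)) (M := N × ℝ)
      (I' := 𝓘(ℝ, E')) (N := N))
    (isSpacelikeImmersion_cylSlice G hG t) with hgt
  set K := G.secondFundamentalForm 𝓘(ℝ, E') (fun y : N ↦ ((y, t) : N × ℝ))
    (fun y ↦ velocity (𝓘(ℝ, E').prod 𝓘(ℝ, ℝ)) (fun s : ℝ ↦ ((y, s) : N × ℝ)) t) (ψ.symm p)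
    with hK
  -- the transported form on `T_p ψ.target = E'`
  set L : E' →ₗ[ℝ] E' := (mfderiv 𝓘(ℝ, E') 𝓘(ℝ, E') (MaxAtlasChart.inv ψ) p).toLinearMap
    with hL
  set K' : LinearMap.BilinForm ℝ E' := K.comp L L with hK'
  have hKK' : ∀ v w, K' v w = K (mfderiv 𝓘(ℝ, E') 𝓘(ℝ, E') (MaxAtlasChart.inv ψ) p v)
      (mfderiv 𝓘(ℝ, E') 𝓘(ℝ, E') (MaxAtlasChart.inv ψ) p w) := fun v w ↦ rfl
  have htr : (MaxAtlasChart.metric gt hψ).trace p K' = gt.trace (ψ.symm p) K :=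
    trace_comap_eq gt PseudoRiemannianMetric.contMDiff_pullbackBilin_holds
      (MaxAtlasChart.contMDiff_inv hψ) (MaxAtlasChart.injective_mfderiv_inv hψ) rfl p K' K hKK'
  show gt.trace (ψ.symm p) K = _
  rw [← htr]
  refine OpensChart.trace_eq_mtrAt (U := MaxAtlasChart.target ψ) (g := MaxAtlasChart.metric gt hψ)
    (G := fun y ↦ F y t) (fun y ↦ ?_) p K' _ fun v w ↦ ?_
  · rw [hF]
    exact MaxAtlasChart.metric_val_eq_repr gt hψ y
  · rw [hKK', MaxAtlasChart.mfderiv_inv hψ, FunLike.coe_smul, Pi.smul_apply,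
      FunLike.coe_smul, Pi.smul_apply, smul_eq_mul]
    exact secondFundamentalForm_slice_eq_half_deriv G hG hcyl hψ F hF p t v w

omit [CompleteSpace E'] in
/-- **`|K_t|²` of the slice in the chart**: `|K_t|²(ψ⁻¹ p) = normSqAt F(·,t) p (½ ∂_t F(p,t))`.
[cite: ONeill1983, Ch. 3, Prop. 3.59 and pp. 60–61] -/
theorem normSq_slice_eq_normSqAt (p : MaxAtlasChart.target ψ) (t : ℝ) :
    (G.inducedMetric (fun y : N ↦ ((y, t) : N × ℝ))
        (contMDiff_pullbackBilin_holds (I := 𝓘(ℝ, E').prod 𝓘(ℝ, ℝ)) (M := N × ℝ)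
          (I' := 𝓘(ℝ, E')) (N := N))
        (isSpacelikeImmersion_cylSlice G hG t)).normSq (ψ.symm p)
        (G.secondFundamentalForm 𝓘(ℝ, E') (fun y : N ↦ ((y, t) : N × ℝ))
          (fun y ↦ velocity (𝓘(ℝ, E').prod 𝓘(ℝ, ℝ)) (fun s : ℝ ↦ ((y, s) : N × ℝ)) t)
          (ψ.symm p)) =
      MetricCoord.normSqAt (fun y ↦ F y t) p ((2⁻¹ : ℝ) • deriv (fun s : ℝ ↦ F p s) t) := by
  set gt := G.inducedMetric (fun y : N ↦ ((y, t) : N × ℝ))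
    (contMDiff_pullbackBilin_holds (I := 𝓘(ℝ, E').prod 𝓘(ℝ, ℝ)) (M := N × ℝ)
      (I' := 𝓘(ℝ, E')) (N := N))
    (isSpacelikeImmersion_cylSlice G hG t) with hgt
  set K := G.secondFundamentalForm 𝓘(ℝ, E') (fun y : N ↦ ((y, t) : N × ℝ))
    (fun y ↦ velocity (𝓘(ℝ, E').prod 𝓘(ℝ, ℝ)) (fun s : ℝ ↦ ((y, s) : N × ℝ)) t) (ψ.symm p)
    with hK
  set L : E' →ₗ[ℝ] E' := (mfderiv 𝓘(ℝ, E') 𝓘(ℝ, E') (MaxAtlasChart.inv ψ) p).toLinearMap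
    with hL
  set K' : LinearMap.BilinForm ℝ E' := K.comp L L with hK'
  have hKK' : ∀ v w, K' v w = K (mfderiv 𝓘(ℝ, E') 𝓘(ℝ, E') (MaxAtlasChart.inv ψ) p v)
      (mfderiv 𝓘(ℝ, E') 𝓘(ℝ, E') (MaxAtlasChart.inv ψ) p w) := fun v w ↦ rfl
  have hns : (MaxAtlasChart.metric gt hψ).normSq p K' = gt.normSq (ψ.symm p) K :=
    normSq_comap_eq gt PseudoRiemannianMetric.contMDiff_pullbackBilin_holds
      (MaxAtlasChart.contMDiff_inv hψ) (MaxAtlasChart.injective_mfderiv_inv hψ) rfl p K' K hKK'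
  rw [← hns]
  refine OpensChart.normSq_eq_normSqAt (U := MaxAtlasChart.target ψ)
    (g := MaxAtlasChart.metric gt hψ) (G := fun y ↦ F y t) (fun y ↦ ?_) p K' _ fun v w ↦ ?_
  · rw [hF]
    exact MaxAtlasChart.metric_val_eq_repr gt hψ y
  · rw [hKK', MaxAtlasChart.mfderiv_inv hψ, FunLike.coe_smul, Pi.smul_apply,
      FunLike.coe_smul, Pi.smul_apply, smul_eq_mul]
    exact secondFundamentalForm_slice_eq_half_deriv G hG hcyl hψ F hF p t v w

omit [G.HasLeviCivita] hcyl in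
/-- **The scalar curvature of the slice in the chart**: `scal_{g_t}(ψ⁻¹ p) = scalAt F(·,t) p`
(`MaxAtlasChart.scalarCurvature_inv_eq`). [cite: ONeill1983, Ch. 3, Prop. 3.59] -/
theorem scalarCurvature_slice_eq_scalAt (p : MaxAtlasChart.target ψ) (t : ℝ) :
    haveI := (G.inducedMetric (fun y : N ↦ ((y, t) : N × ℝ))
      (contMDiff_pullbackBilin_holds (I := 𝓘(ℝ, E').prod 𝓘(ℝ, ℝ)) (M := N × ℝ)
        (I' := 𝓘(ℝ, E')) (N := N))
      (isSpacelikeImmersion_cylSlice G hG t)).hasLeviCivita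
    (G.inducedMetric (fun y : N ↦ ((y, t) : N × ℝ))
        (contMDiff_pullbackBilin_holds (I := 𝓘(ℝ, E').prod 𝓘(ℝ, ℝ)) (M := N × ℝ)
          (I' := 𝓘(ℝ, E')) (N := N))
        (isSpacelikeImmersion_cylSlice G hG t)).scalarCurvature (ψ.symm p) =
      MetricCoord.scalAt (fun y ↦ F y t) p := by
  haveI := (G.inducedMetric (fun y : N ↦ ((y, t) : N × ℝ))
    (contMDiff_pullbackBilin_holds (I := 𝓘(ℝ, E').prod 𝓘(ℝ, ℝ)) (M := N × ℝ)
      (I' := 𝓘(ℝ, E')) (N := N))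
    (isSpacelikeImmersion_cylSlice G hG t)).hasLeviCivita
  have hfun : (fun y ↦ F y t) = MaxAtlasChart.metricRepr
      (G.inducedMetric (fun x : N ↦ ((x, t) : N × ℝ))
        (contMDiff_pullbackBilin_holds (I := 𝓘(ℝ, E').prod 𝓘(ℝ, ℝ)) (M := N × ℝ)
          (I' := 𝓘(ℝ, E')) (N := N))
        (isSpacelikeImmersion_cylSlice G hG t)) hψ := funext fun y ↦ hF y t
  rw [hfun]
  exact MaxAtlasChart.scalarCurvature_inv_eq _ hψ p

/-- **Formula (9) in coordinates** (Bär–Gauduchon–Moroianu 2005, Prop. 4.1; Bär–Hanke 2023, §3,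
(9), in the `H`-form `scal_G = scal_{g_t} - |K_t|² - H_t² - 2 ∂_t H_t` of
`cyl_scalarCurvature_eq`): at `(ψ⁻¹ p, t)`,
`scal_G = scalAt F(·,t) p − normSqAt F(·,t) p (½Ḟ) − (mtrAt F(·,t) p (½Ḟ))²
          − 2 ∂_τ|_{τ=t} mtrAt F(·,τ) p (½Ḟ(p,τ))`. [cite: BarHanke2023, §3, (9)] -/
theorem cyl_scalarCurvature_eq_coord (p : MaxAtlasChart.target ψ) (t : ℝ) :
    G.scalarCurvature (ψ.symm p, t) =
      MetricCoord.scalAt (fun y ↦ F y t) p -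
        MetricCoord.normSqAt (fun y ↦ F y t) p ((2⁻¹ : ℝ) • deriv (fun s : ℝ ↦ F p s) t) -
        MetricCoord.mtrAt (fun y ↦ F y t) p ((2⁻¹ : ℝ) • deriv (fun s : ℝ ↦ F p s) t) ^ 2 -
        2 * deriv (fun τ ↦ MetricCoord.mtrAt (fun y ↦ F y τ) p
          ((2⁻¹ : ℝ) • deriv (fun s : ℝ ↦ F p s) τ)) t := by
  haveI := (G.inducedMetric (fun y : N ↦ ((y, t) : N × ℝ))
    (contMDiff_pullbackBilin_holds (I := 𝓘(ℝ, E').prod 𝓘(ℝ, ℝ)) (M := N × ℝ)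
      (I' := 𝓘(ℝ, E')) (N := N))
    (isSpacelikeImmersion_cylSlice G hG t)).hasLeviCivita
  have h := cyl_scalarCurvature_eq G hG hcyl (ψ.symm p) t
  rw [h, scalarCurvature_slice_eq_scalAt G hG hψ F hF p t,
    normSq_slice_eq_normSqAt G hG hcyl hψ F hF p t, meanCurvature_slice_eq_mtrAt G hG hcyl hψ F hF p t]
  have hH : (fun τ ↦ G.meanCurvature (fun y : N ↦ ((y, τ) : N × ℝ))
      (contMDiff_pullbackBilin_holds (I := 𝓘(ℝ, E').prod 𝓘(ℝ, ℝ)) (M := N × ℝ)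
        (I' := 𝓘(ℝ, E')) (N := N))
      (isSpacelikeImmersion_cylSlice G hG τ)
      (fun y ↦ velocity (𝓘(ℝ, E').prod 𝓘(ℝ, ℝ)) (fun s : ℝ ↦ ((y, s) : N × ℝ)) τ) (ψ.symm p)) =
      fun τ ↦ MetricCoord.mtrAt (fun y ↦ F y τ) p ((2⁻¹ : ℝ) • deriv (fun s : ℝ ↦ F p s) τ) :=
    funext fun τ ↦ meanCurvature_slice_eq_mtrAt G hG hcyl hψ F hF p τ
  rw [hH]

end Dictionary

end Literature.Geometry.Riemannian
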